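import Summits.ResolutionOfSingularities.ResolutionOfSingularities.Theorems.NearExitWeight
import Summits.ResolutionOfSingularities.ResolutionOfSingularities.Theorems.NearExitDirectrix
import Summits.ResolutionOfSingularities.ResolutionOfSingularities.Theorems.NearExitFibre

/-!
# NearExit (S6-R) — the RATIONAL near point persists: `Persists c ŵ τ J n`

Node «NearExit» of `decomp-res-lens-2` (g33), see `NearExitTau.lean`.  Ring-level form of the case (R) of the proof of
`VeryNearCutClasses.VeryNearExit`: if the point `x′` of the first blow-up lying over `y` is the RATIONAL point
`x′_ŵ` of the exceptional divisor (direction `ŵ`, normalised `ŵ_j = 1`, `ŵ₀ ∈ 𝔪`), is NEAR (`J′ ⊆ 𝔪ⁿ` for the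
controlled transform `J′ ∋ h` whenever `c_jⁿ h ∈ J𝒪`) and has `τ(J′, n) ≤ 1`, then `Persists c ŵ τ J n` holds for every
transversal parameter `τ ∈ 𝔪 ∖ 𝔫_ŵ` — contradicting clause (iii) of `HasNearGenericFace` for a listed direction.

Dictionary (ring level): `σ : R = 𝒪_{Y,y} → L = 𝒪_{Y′,x′}`, `t = σ(c_j)` the exceptional parameter,
`y_k = c_k/c_j − ŵ_k ∈ 𝔪_L` (`k ≠ j`, `y_j = 0`) the translated chart coordinates, `(t, (y_k)_{k≠j})` part of a regular
system of parameters of `L`, and RATIONALITY `L = σ(R) + 𝔪_L`.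

Proof (`persists_of_rational`): ORDER `J ⊆ 𝔪_Rⁿ` and clause 1 `J ⊆ Q_ŵ(2n)` by the contraction lemma
(`NearExitContraction`, `NearExitWeight`); clause 2 from the uniform directrix `(z₀ + r t)ⁿ` at `x′`
(`NearExitDirectrix.directrix_shape`), rationalised (`r ≡ σ r₀`, `μ ≡ σ u (mod 𝔪_L)`), pulled back by
`t·(z₀ + σ r₀ t) = σ(c₀ + r₀ c_j²)` and the contraction lemma, and re-expressed through `τ² ≡ δ² c_j² (mod W₃)`.

Sources: [CossartPiltant2008] proof of Prop. 4.2 (a)(b); [Hironaka1970] §1 Thm. 3; [CossartJannsenSaito2020] Ch. 2.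
-/

open IsLocalRing
open Literature.AlgebraicGeometry.Resolution
open MvPolynomial
open Summit.ResolutionOfSingularities.ResolutionOfSingularities.Theorems.PinchTower

namespace Summit.ResolutionOfSingularities.ResolutionOfSingularities.Theorems.NearExit

section Scaling

variable {R L : Type} [CommRing R] [CommRing L]

/-- Homogeneous scaling: `G(τ·z) = τᵃ·G(z)` for a form `G` of degree `a`. [folklore] -/
theorem eval_mul_of_isHomogeneous {m : ℕ} (τ : L) (z : Fin m → L) {G : MvPolynomial (Fin m) L} {a : ℕ}
    (hG : G.IsHomogeneous a) : eval (fun k => τ * z k) G = τ ^ a * eval z G := by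
  classical
  conv_lhs => rw [G.as_sum]
  conv_rhs => rw [G.as_sum]
  rw [map_sum, map_sum, Finset.mul_sum]
  refine Finset.sum_congr rfl fun α hα => ?_
  have hN : α.degree = a := by
    rw [Finsupp.degree_eq_weight_one]; exact hG (mem_support_iff.mp hα)
  rw [eval_monomial, eval_monomial, Finsupp.prod_pow, Finsupp.prod_pow]
  simp_rw [mul_pow]
  rw [Finset.prod_mul_distrib, Finset.prod_pow_eq_pow_sum, ← degree_eq_sum_univ, hN]
  ring

end Scaling

section PairTwist

variable {A : Type} [CommRing A] [IsLocalRing A]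

/-- `(y₀, t)` r.s.o.p.-part ⇒ `(y₀ + s t, t)` r.s.o.p.-part (same ideal). [folklore] -/
theorem isRsopPart_pair_add_mul {y₀ t : A} (h : IsRsopPart ![y₀, t]) (s : A) : IsRsopPart ![y₀ + s * t, t] := by
  have hpair : Ideal.span (Set.range ![y₀ + s * t, t]) = Ideal.span (Set.range ![y₀, t]) := by
    apply le_antisymm
    · rw [Ideal.span_le]
      rintro _ ⟨i, rfl⟩
      fin_cases i
      · exact Ideal.add_mem _ (Ideal.subset_span ⟨0, rfl⟩) (Ideal.mul_mem_left _ _ (Ideal.subset_span ⟨1, rfl⟩))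
      · exact Ideal.subset_span ⟨1, rfl⟩
    · rw [Ideal.span_le]
      rintro _ ⟨i, rfl⟩
      fin_cases i
      · have hmem : (y₀ + s * t) - s * t ∈ Ideal.span (Set.range ![y₀ + s * t, t]) :=
          Ideal.sub_mem _ (Ideal.subset_span ⟨0, rfl⟩) (Ideal.mul_mem_left _ _ (Ideal.subset_span ⟨1, rfl⟩))
        simpa using hmem
      · exact Ideal.subset_span ⟨1, rfl⟩
  obtain ⟨hR, e, z, hdim, hspan⟩ := h
  refine ⟨hR, e, z, hdim, ?_⟩
  rw [Ideal.span_union, hpair, ← Ideal.span_union, hspan]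

end PairTwist

section Rational

variable {R L : Type} [CommRing R] [IsLocalRing R] [CommRing L] [IsLocalRing L] [IsNoetherianRing L]
  (σ : R →+* L) {d : ℕ} (c : Fin (d + 1) → R) (hc : Ideal.span (Set.range c) = maximalIdeal R)
  (j : Fin (d + 1)) (hj : j ≠ 0) (ŵ : Fin (d + 1) → R) (hŵj : ŵ j = 1) (hŵ0 : ŵ 0 ∈ maximalIdeal R)
  (y : Fin (d + 1) → L) (hyj : y j = 0) (hy : ∀ k, k ≠ j → σ (c k - ŵ k * c j) = σ (c j) * y k)
  (hrsop : IsRsopPart (Function.update y j (σ (c j))))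
  (hres : ∀ l : L, ∃ r : R, l - σ r ∈ maximalIdeal L)
  {n : ℕ} (hn : 1 ≤ n) {J : Ideal R} {J' : Ideal L}
  (hcol : ∀ h : L, σ (c j) ^ n * h ∈ J.map σ → h ∈ J') (hnear : J' ≤ maximalIdeal L ^ n)
  {m : ℕ} (x : Fin m → L) (hx : Ideal.span (Set.range x) = maximalIdeal L) (hτ : hironakaTauAt x J' n ≤ 1)
  {G : MvPolynomial (Fin (d + 1)) R} (hG : G.IsHomogeneous (n + 1)) (hfJ : c 0 ^ n + eval c G ∈ J)

omit [IsLocalRing R] in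
/-- The twisted basis generates the same ideal as `c`. [this file] -/
theorem span_twist_eq : Ideal.span (Set.range (Function.update (fun k => c k - ŵ k * c j) j (c j))) =
    Ideal.span (Set.range c) := by
  apply le_antisymm
  · rw [Ideal.span_le]
    rintro _ ⟨k, rfl⟩
    by_cases hk : k = j
    · subst hk; rw [Function.update_self]; exact Ideal.subset_span ⟨k, rfl⟩
    · rw [Function.update_of_ne hk]
      exact Ideal.sub_mem _ (Ideal.subset_span ⟨k, rfl⟩) (Ideal.mul_mem_left _ _ (Ideal.subset_span ⟨j, rfl⟩))
  · rw [Ideal.span_le]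
    rintro _ ⟨k, rfl⟩
    have hj' : c j ∈ Ideal.span (Set.range (Function.update (fun k => c k - ŵ k * c j) j (c j))) := by
      have := Ideal.subset_span (s := Set.range (Function.update (fun k => c k - ŵ k * c j) j (c j))) ⟨j, rfl⟩
      rwa [Function.update_self] at this
    by_cases hk : k = j
    · subst hk; exact hj'
    · have h1 := Ideal.subset_span (s := Set.range (Function.update (fun k => c k - ŵ k * c j) j (c j))) ⟨k, rfl⟩
      rw [Function.update_of_ne hk] at h1
      have : c k = (c k - ŵ k * c j) + ŵ k * c j := by ring
      rw [SetLike.mem_coe, this]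
      exact Ideal.add_mem _ h1 (Ideal.mul_mem_left _ _ hj')

include hc hj hŵj hŵ0 hyj hy hrsop hres hn hcol hnear hx hτ hG hfJ in
/-- **THE RATIONAL NEAR POINT PERSISTS** [KERNEL R]: under the dictionary of the file header (near rational point
`x′_ŵ` of the first blow-up with `τ(J′, n) ≤ 1`, `f = c₀ⁿ + G(c) ∈ J`), `Persists c ŵ τ J n` for every
`τ ∈ 𝔪 ∖ 𝔫_ŵ`. [cite: CossartPiltant2008, Prop. 4.2] [cite: Hironaka1970, Thm. 3] -/
theorem persists_of_rational (τ : R) (hτm : τ ∈ maximalIdeal R) (hτN : τ ∉ VeryNearCutClasses.nIdeal c ŵ) :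
    VeryNearCutClasses.Persists c ŵ τ J n := by
  classical
  -- the dictionary
  set t : L := σ (c j) with ht
  set b : Fin (d + 1) → R := Function.update (fun k => c k - ŵ k * c j) j (c j) with hb
  have hbjc : b j = c j := by rw [hb, Function.update_self]
  have hbk' : ∀ k, k ≠ j → b k = c k - ŵ k * c j := fun k hk => by rw [hb, Function.update_of_ne hk]
  have hbj : σ (b j) = t := by rw [hbjc]
  have hbk : ∀ k, k ≠ j → σ (b k) = t * y k := fun k hk => by rw [hbk' k hk]; exact hy k hk
  have hbm : Ideal.span (Set.range b) = maximalIdeal R := (span_twist_eq c j ŵ).trans hc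
  have hcm : ∀ k, c k ∈ maximalIdeal R := fun k => hc ▸ Ideal.subset_span ⟨k, rfl⟩
  have hyk : ∀ k, Function.update y j t k ∈ maximalIdeal L := hrsop.mem_maximalIdeal
  have htm : t ∈ maximalIdeal L := by have := hyk j; rwa [Function.update_self] at this
  have hW : ∀ {l : ℕ} {g : R}, σ g ∈ maximalIdeal L ^ l → g ∈ wIdeal j b l := fun hg =>
    mem_wIdeal_of_map_mem_pow σ j b t y hbj hbk hrsop hbm hg
  have hWQ : ∀ l, wIdeal j b l ≤ VeryNearCutClasses.qIdeal c ŵ l := fun l =>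
    wIdeal_le_qIdeal c ŵ j hŵj (hcm j) l
  -- `σ b_k = t · (update y j 1)_k`
  have hσb : σ ∘ b = fun k => t * Function.update y j 1 k := by
    funext k
    by_cases hk : k = j
    · subst hk; rw [Function.comp_apply, hbj, Function.update_self, mul_one]
    · rw [Function.comp_apply, hbk k hk, Function.update_of_ne hk]
  -- scaling of forms in `b`
  have hscale : ∀ (a : ℕ) (F : MvPolynomial (Fin (d + 1)) R), F.IsHomogeneous a →
      σ (eval b F) = t ^ a * eval (Function.update y j 1) (MvPolynomial.map σ F) := by
    intro a F hF
    rw [map_eval_eq_eval_map, hσb, eval_mul_of_isHomogeneous t _ (hF.map σ)]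
  -- KEY: `g ∈ J ∩ 𝔪ᵃ (a ≤ n)` ⇒ `σ g = tᵃ h` with `h ∈ J′`
  have key : ∀ a ≤ n, ∀ g ∈ J, g ∈ maximalIdeal R ^ a → ∃ h ∈ J', σ g = t ^ a * h := by
    intro a ha g hgJ hga
    obtain ⟨F, hFh, hFe⟩ := exists_isHomogeneous_of_mem_span_pow b a (by rw [hbm]; exact hga)
    have h1 : σ g = t ^ a * eval (Function.update y j 1) (MvPolynomial.map σ F) := by
      rw [← hFe]; exact hscale a F hFh
    refine ⟨eval (Function.update y j 1) (MvPolynomial.map σ F), hcol _ ?_, h1⟩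
    have : t ^ n * eval (Function.update y j 1) (MvPolynomial.map σ F) = σ (c j ^ (n - a) * g) := by
      rw [map_mul, map_pow, h1, ← ht, ← mul_assoc, ← pow_add, Nat.sub_add_cancel ha]
    rw [this]
    exact Ideal.mem_map_of_mem _ (Ideal.mul_mem_left _ _ hgJ)
  -- ORDER: `J ⊆ 𝔪_Rⁿ`
  have hord : ∀ a ≤ n, ∀ g ∈ J, g ∈ maximalIdeal R ^ a := by
    intro a
    induction a with
    | zero => intro _ g _; rw [pow_zero, Ideal.one_eq_top]; exact Submodule.mem_top
    | succ a ih =>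
      intro ha g hgJ
      obtain ⟨h, hhJ', hgh⟩ := key a (by omega) g hgJ (ih (by omega) g hgJ)
      have h1 : σ g ∈ maximalIdeal L ^ (n + a) := by
        rw [hgh, add_comm, pow_add]
        exact Ideal.mul_mem_mul (Ideal.pow_mem_pow htm a) (hnear hhJ')
      exact wIdeal_le_pow j b hbm (l := n + a) (m := a + 1) (by omega) (hW h1)
  have hkey : ∀ g ∈ J, ∃ h ∈ J', σ g = t ^ n * h := fun g hg => key n le_rfl g hg (hord n le_rfl g hg)
  -- CLAUSE 1
  have clause1 : J ≤ VeryNearCutClasses.qIdeal c ŵ (2 * n) := by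
    intro g hg
    obtain ⟨h, hhJ', hgh⟩ := hkey g hg
    have h1 : σ g ∈ maximalIdeal L ^ (2 * n) := by
      rw [hgh, two_mul, pow_add]
      exact Ideal.mul_mem_mul (Ideal.pow_mem_pow htm n) (hnear hhJ')
    exact hWQ (2 * n) (hW h1)
  refine ⟨clause1, ?_⟩
  -- CLAUSE 2.  (V1) the pair `(z₀, t)` with `z₀ = y₀ + σ ŵ₀`
  set z : Fin (d + 1) → L := fun k => y k + σ (ŵ k) with hz
  have hσc : ∀ k, σ (c k) = t * z k := by
    intro k
    by_cases hk : k = j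
    · subst hk; rw [hz]; dsimp only; rw [hyj, hŵj, map_one, zero_add, mul_one]
    · have := hy k hk
      rw [map_sub, map_mul, sub_eq_iff_eq_add] at this
      rw [this, hz, ← ht]; ring
  obtain ⟨s₀, hs₀⟩ : ∃ s₀ : L, σ (ŵ 0) = t * s₀ := by
    obtain ⟨u, hu⟩ := Ideal.mem_span_range_iff_exists_fun.mp (show ŵ 0 ∈ Ideal.span (Set.range b) by
      rw [hbm]; exact hŵ0)
    refine ⟨∑ k, σ (u k) * Function.update y j 1 k, ?_⟩
    rw [← hu, map_sum, Finset.mul_sum]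
    refine Finset.sum_congr rfl fun k _ => ?_
    rw [map_mul, show σ (b k) = t * Function.update y j 1 k from congrFun hσb k]
    ring
  have hY0 : IsRsopPart ![y 0, t] := by
    have h := hrsop.comp ![0, j] (fun a a' h => by
      fin_cases a <;> fin_cases a'
      · rfl
      · exact absurd h (by simpa using hj.symm)
      · exact absurd h (by simpa using hj)
      · rfl)
    convert h using 1
    funext i
    fin_cases i
    · simp [Function.update_of_ne hj.symm]
    · simp
  have hz0 : z 0 = y 0 + s₀ * t := by rw [hz]; dsimp only; rw [hs₀, mul_comm]
  have hY : IsRsopPart ![z 0, t] := by rw [hz0]; exact isRsopPart_pair_add_mul hY0 s₀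
  have hz0m : z 0 ∈ maximalIdeal L := hY.mem_maximalIdeal 0
  -- (V2) the chart element `f′ = z₀ⁿ + t·G^σ(z) ∈ J′`, `f′ ≡ z₀ⁿ (mod t)`
  set f' : L := z 0 ^ n + t * eval z (MvPolynomial.map σ G) with hf'
  have hf'σ : t ^ n * f' = σ (c 0 ^ n + eval c G) := by
    rw [map_add, map_pow, hσc 0, map_eval_eq_eval_map, show σ ∘ c = fun k => t * z k from funext hσc,
      eval_mul_of_isHomogeneous t z (hG.map σ), hf']
    ring
  have hf'J' : f' ∈ J' := hcol f' (by rw [hf'σ]; exact Ideal.mem_map_of_mem _ hfJ)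
  have hf't : f' - z 0 ^ n ∈ Ideal.span (Set.range ![t]) := by
    have : f' - z 0 ^ n = t * eval z (MvPolynomial.map σ G) := by rw [hf']; ring
    rw [this]
    exact Ideal.mul_mem_right _ _ (Ideal.subset_span ⟨0, rfl⟩)
  -- (V3) uniform directrix `(z₀ + r t)ⁿ`
  obtain ⟨ℓ, hℓm, hℓ⟩ := exists_uniform_directrix x hx hn hτ
  obtain ⟨r, hr⟩ := directrix_shape hY hn hnear hf'J' hf't hℓm hℓ
  -- (V4) rationalise `r`: `P = z₀ + σ r₀ · t`, `t P = σ(c₀ + r₀ c_j²)`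
  obtain ⟨r₀, hr₀⟩ := hres r
  set P : L := z 0 + σ r₀ * t with hP
  have hPm : P ∈ maximalIdeal L := Ideal.add_mem _ hz0m (Ideal.mul_mem_left _ _ htm)
  have hrP : ∀ h ∈ J', ∃ μ : L, h - μ * P ^ n ∈ maximalIdeal L ^ (n + 1) := by
    intro h hh
    obtain ⟨μ, hμ⟩ := hr h hh
    refine ⟨μ, ?_⟩
    have hq : (r - σ r₀) * t ∈ maximalIdeal L ^ 2 := by
      rw [pow_two]; exact Ideal.mul_mem_mul hr₀ htm
    have h2 := add_pow_sub_pow_mem hPm hq n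
    have e1 : z 0 + r * t = P + (r - σ r₀) * t := by rw [hP]; ring
    have : h - μ * P ^ n = (h - μ * (z 0 + r * t) ^ n) + μ * ((P + (r - σ r₀) * t) ^ n - P ^ n) := by
      rw [e1]; ring
    rw [this]
    exact Ideal.add_mem _ hμ (Ideal.mul_mem_left _ _ h2)
  set p₁ : R := c 0 + r₀ * c j ^ 2 with hp₁
  have htP : t * P = σ p₁ := by
    rw [hp₁, map_add, map_mul, map_pow, hσc 0, hP, ← ht]; ring
  -- (V5) pull back: `g − u p₁ⁿ ∈ W_{2n+1}` for `g ∈ J`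
  have hV5 : ∀ g ∈ J, ∃ u : R, g - u * p₁ ^ n ∈ wIdeal j b (2 * n + 1) := by
    intro g hg
    obtain ⟨h, hhJ', hgh⟩ := hkey g hg
    obtain ⟨μ, hμ⟩ := hrP h hhJ'
    obtain ⟨u, hu⟩ := hres μ
    refine ⟨u, hW ?_⟩
    have h1 : h - σ u * P ^ n ∈ maximalIdeal L ^ (n + 1) := by
      have : h - σ u * P ^ n = (h - μ * P ^ n) + (μ - σ u) * P ^ n := by ring
      rw [this]
      refine Ideal.add_mem _ hμ ?_
      rw [pow_succ']
      exact Ideal.mul_mem_mul hu (Ideal.pow_mem_pow hPm n)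
    have h2 : σ (g - u * p₁ ^ n) = t ^ n * (h - σ u * P ^ n) := by
      rw [map_sub, map_mul, map_pow, ← htP, hgh]; ring
    rw [h2, show 2 * n + 1 = n + (n + 1) by ring, pow_add]
    exact Ideal.mul_mem_mul (Ideal.pow_mem_pow htm n) h1
  -- (V6) `τ = δ c_j + ν`, `δ` a unit, `ν ∈ W₂`; `p = c₀ + r′ τ²` with `r′ = r₀ δ⁻²`; `p₁ − p ∈ W₃`, `p ∈ W₂`
  obtain ⟨s, hs⟩ := Ideal.mem_span_range_iff_exists_fun.mp (show τ ∈ Ideal.span (Set.range b) by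
    rw [hbm]; exact hτm)
  set ν : R := ∑ i : Fin d, s (j.succAbove i) * b (j.succAbove i) with hν
  have hτeq : τ = s j * c j + ν := by rw [← hs, Fin.sum_univ_succAbove _ j, hbjc]
  have hνW : ν ∈ wIdeal j b 2 :=
    Ideal.sum_mem _ fun i _ => Ideal.mul_mem_left _ _ (b_mem_wIdeal_two j b (Fin.succAbove_ne j i))
  have hνN : ν ∈ VeryNearCutClasses.nIdeal c ŵ := by
    refine Ideal.sum_mem _ fun i _ => Ideal.mul_mem_left _ _ ?_
    rw [hbk' _ (Fin.succAbove_ne j i)]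
    refine Ideal.mem_sup_left (Ideal.subset_span ⟨j, j.succAbove i, ?_⟩)
    rw [hŵj, one_mul]
  have hδ : IsUnit (s j) := by
    by_contra hδ
    apply hτN
    rw [hτeq]
    refine Ideal.add_mem _ (Ideal.mem_sup_right ?_) hνN
    rw [pow_two]
    exact Ideal.mul_mem_mul ((IsLocalRing.mem_maximalIdeal _).mpr hδ) (hcm j)
  obtain ⟨δ, hδ⟩ := hδ
  have hcjW : c j ∈ wIdeal j b 1 := by rw [← hbjc]; exact bj_mem_wIdeal_one j b
  have h𝔪W : maximalIdeal R ≤ wIdeal j b 1 := maximalIdeal_le_wIdeal_one j b hbm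
  -- `τ² = δ² c_j² + ν₂`, `ν₂ ∈ W₃`
  have hν₂ : τ ^ 2 - s j ^ 2 * c j ^ 2 ∈ wIdeal j b 3 := by
    have : τ ^ 2 - s j ^ 2 * c j ^ 2 = (2 * s j) * (c j * ν) + ν * ν := by rw [hτeq]; ring
    rw [this]
    refine Ideal.add_mem _ (Ideal.mul_mem_left _ _ (mul_mem_wIdeal j b hcjW hνW)) ?_
    exact wIdeal_anti j b (by norm_num) (mul_mem_wIdeal j b hνW hνW)
  set r' : R := r₀ * ↑δ⁻¹ ^ 2 with hr'
  refine ⟨r', fun g hg => ?_⟩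
  set p : R := c 0 + r' * τ ^ 2 with hp
  have hpp₁ : p - p₁ ∈ wIdeal j b 3 := by
    have : p - p₁ = r₀ * ↑δ⁻¹ ^ 2 * (τ ^ 2 - s j ^ 2 * c j ^ 2) := by
      rw [hp, hp₁, hr', ← hδ, mul_sub, show r₀ * ↑δ⁻¹ ^ 2 * (↑δ ^ 2 * c j ^ 2) =
        r₀ * (↑δ⁻¹ * ↑δ) ^ 2 * c j ^ 2 by ring, Units.inv_mul, one_pow, mul_one]
      ring
    rw [this]
    exact Ideal.mul_mem_left _ _ hν₂
  have hpW : p ∈ wIdeal j b 2 := by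
    rw [hp]
    refine Ideal.add_mem _ ?_ ?_
    · have : c 0 = b 0 + ŵ 0 * b j := by rw [hbk' 0 hj.symm, hbjc]; ring
      rw [this]
      exact Ideal.add_mem _ (b_mem_wIdeal_two j b hj.symm)
        (mul_mem_wIdeal j b (h𝔪W hŵ0) (bj_mem_wIdeal_one j b))
    · rw [pow_two]
      exact Ideal.mul_mem_left _ _ (mul_mem_wIdeal j b (h𝔪W hτm) (h𝔪W hτm))
  -- `p₁ⁿ − pⁿ ∈ W_{2n+1}`
  have hpow : p₁ ^ n - p ^ n ∈ wIdeal j b (2 * n + 1) := by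
    have e : p₁ = p + (p₁ - p) := by ring
    have hq : p₁ - p ∈ wIdeal j b 3 := by
      rw [show p₁ - p = -(p - p₁) by ring]; exact Submodule.neg_mem _ hpp₁
    rw [e]
    exact add_pow_sub_pow_mem_wIdeal j b hpW hq n
  -- conclude
  obtain ⟨u, hu⟩ := hV5 g hg
  have h1 : g - u * p ^ n ∈ wIdeal j b (2 * n + 1) := by
    have : g - u * p ^ n = (g - u * p₁ ^ n) + u * (p₁ ^ n - p ^ n) := by ring
    rw [this]
    exact Ideal.add_mem _ hu (Ideal.mul_mem_left _ _ hpow)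
  have : g = (g - u * p ^ n) + u * p ^ n := by ring
  rw [this]
  exact Ideal.add_mem _ (Ideal.mem_sup_left (hWQ _ h1))
    (Ideal.mem_sup_right (Ideal.mul_mem_left _ _ (Ideal.mem_span_singleton_self _)))

end Rational

end Summit.ResolutionOfSingularities.ResolutionOfSingularities.Theorems.NearExit
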